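import Summits.BirchSwinnertonDyer.BirchSwinnertonDyer.Theorems.ByReductionTypeAtTwoMultSelmerRankDisplay
import Summits.BirchSwinnertonDyer.BirchSwinnertonDyer.Theorems.ByReductionTypeAtTwoSlopePinchAlgebra
import HarnessLib

/-!
# Route `ByReductionTypeAtTwo`, child `MultLowerHalfAtTwo` (item stmt-BirchSwinnertonDyer-19923; also 19922): the
# SLOPE-PINCH door at a NON-SPLIT multiplicative `2` — `BSD₂(E)` (both halves) from the integral Kato divisibility,
# `λ(X) ≥ 3`, and the `2`-adic valuations of the FIRST THREE COEFFICIENTS of `ϖ·L₂(E)` (no `λ(X) ≥ λ_an` input)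

HONEST FRAMING (cell `bsd-2adic`, run/shared/lean/pub/bsd-2adic/, seat `bsd-2adic-mult-3` GEN 9, HUMAN RULINGS
D-0036 / D-0054 / D-0074 row (A)): research route; THEOREMS ONLY — no definition, no new named fact, nothing
asserted, nothing booked; BSD is not proved by any of this. PARTITION (D-0054): X5@2 mult, non-split, `E[2]`
irreducible with surjective `ρ_{E,2^∞}` and `Δ < 0` (the habitat of the INT door T-KATO2-NSMULT), aimed at the ONE
door-level residue class of item 19923, 412830t (`λ_an = 12`: the `λ`-pinch needs a layer-`4` Selmer count, GEN 8
kit j262312 infeasible; `#Ш_an = 2⁸`: descent needs level `16`, no engine) × p = 2 — types-the-object-of (items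
19923 / 19922 per class by ONE door); closes none by itself.

## The road

The Kato-INT pinch doors (`X5.O1.bsdp_two_nonsplit_of_katoIntPinch'`, this seat's `MultSelmerRank.*`) turn the
integral divisibility `L₀ = f_X · b` (`L₀ = ι⁻¹(ϖ·L₂)`, T-KATO2-NSMULT) into the equality `char_Λ X = (L₀)` by
`λ(X) ≥ λ_an` (`X1.MuLambda.span_eq_span_iff_mu_le_and_lam_le`). Here the cofactor `b` is shown to be a UNIT by the
pure-algebra SLOPE PINCH `SlopePinch.isUnit_of_slopePinch` (file `…SlopePinchAlgebra`, this seat GEN 9) from: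
`λ(f_X) ≥ 3` (a layer Selmer count, `SelmerLambdaLowerBoundAtTwo W 3`), `v₂(f_X(0)) ≥ 2` (PROVED here from Greenberg's
non-split Euler-characteristic display A235 `hEC`: `f_X(0)·#E(ℚ)(2)² = u·2^{ord₂∏c+1}·#Sel`, odd torsion, `#Sel` even),
and the certificate `v₂(L₀(0)) = s` even, `2^t ∣ L₀'(0)`-coefficient, `v₂([T²]L₀) = 1`, `s + 2 ≤ 2t`. Then
`missingPPartAt_two_nonsplit_of_charIdeal_eq_span` reads off `ord₂ #Ш_an = ord₂ #Ш`.
* §1 `two_le_valuation_constantCoeff_of_eulerChar` — `v₂(f_E(0)) ≥ 2` from A235 + odd torsion + `#Sel_{2^∞}(E/ℚ)` even.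
* §2 `charIdeal_eq_span_of_katoInt_slopePinch_nonsplit` — `char_Λ X = (L₀)` (pure algebra on top of the INT datum).
* §3 doors: `bsdp_two_nonsplit_of_katoInt_slopePinch` (`BSDp W 2` — so both items 19923 / 19922 at the curve), its
  `MissingLowerBoundAt` instance (item 19923), and the display forms with `hper₀` discharged by Česnavičius.

WHAT IS DISPLAYED, NOT PROVED. MEMO: T-KATO2-NSMULT (`hKint : KatoDivisibilityAtTwoNonsplitMultInt W`,
HOME/mult/PROOF-KATO2MULT.md). PRINT: guarded Thm-4.1 analogue `h41`, `hmod`, `hGZK`, Prop. 4.14@2 `h414`,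
Česnavičius `hC`. CERTIFICATES: `μ_an = 0` (`hμan`), the coefficient valuations (`hcoef`: `v₂(c₀) = s`, `2^t ∣ c₁`,
`v₂(c₂) = 1` for every `G ∈ Λ` with `ι G = ϖ·L` — finite checks on the Mazur–Tate–Teitelbaum measure, eng-2's
ENGINE-1 and ENGINE-2), the layer count `2³ ≤ #Sel_{2^∞}(E/ℚ_j)[2]` (`hsel`) and `2 ≤ #Sel_{2^∞}(E/ℚ)[2]` (`hsel₀`), the
decidable data `Mult W 2`, non-split, `TwoAdicSurjective W`, `Δ < 0`, `r_an = 0`. NO `λ_an` certificate is consumed.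

References: R. Greenberg, LNM 1716 (1999), §4 pp. 112–113, Prop. 4.14 (p. 124); K. Kato, Astérisque 295 (2004),
17.11–17.13; B. Mazur, J. Tate, J. Teitelbaum, Invent. Math. 84 (1986), §I.10, §I.14; L. Washington, *Introduction to
Cyclotomic Fields*, §7.1; K. Česnavičius, Compos. Math. 154 (2018), Thm. 1.2; R. L. Miller, LMS J. Comput. Math. 14
(2011), Def. 1.1.
-/

set_option autoImplicit false
set_option linter.dupNamespace false

noncomputable section

open scoped Classical MatrixGroups ModularForm

open CongruenceSubgroup WeierstrassCurve Literature.NumberTheory.EllipticCurves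
  Literature.NumberTheory.EllipticCurves.ModularForms
  Literature.NumberTheory.EllipticCurves.Wuthrich2014
  Literature.NumberTheory.EllipticCurves.Greenberg1999
  Literature.NumberTheory.EllipticCurves.Rank1Residual
  Literature.NumberTheory.EllipticCurves.Rank1Residual.Typed Summit.BirchSwinnertonDyer.Rank1Residual
  Summit.BirchSwinnertonDyer.Rank1Residual.X1.MuLambda
  Summit.BirchSwinnertonDyer.Rank1Residual.X1.MuPart
  Summit.BirchSwinnertonDyer.Rank1Residual.X1.ParitySqueeze
  Summit.BirchSwinnertonDyer.Rank1Residual.X5 Summit.BirchSwinnertonDyer.Rank1Residual.X5.O1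
  Summit.BirchSwinnertonDyer.BirchSwinnertonDyer.Theorems.SlopePinch
  Summit.BirchSwinnertonDyer.BirchSwinnertonDyer.Theorems.MultSelmerRank

namespace Summit.BirchSwinnertonDyer.BirchSwinnertonDyer.Theorems.MultSlopePinch

variable (W : WeierstrassCurve ℚ) [W.IsElliptic] [W.IsGloballyMinimal]

/-! ## §1 `v₂(f_E(0)) ≥ 2` from the non-split Euler-characteristic display -/

/-- **An even finite group: `2 ≤ #G[2] ⇒ 2 ∣ #G`.** [folklore] -/
theorem two_dvd_natCard_of_two_le_natCard_twoTorsion {G : Type*} [AddCommGroup G] [Finite G]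
    (h : 2 ≤ Nat.card {z : G // 2 • z = 0}) : 2 ∣ Nat.card G := by
  haveI : Nontrivial {z : G // 2 • z = 0} := Finite.one_lt_card_iff_nontrivial.mp h
  obtain ⟨⟨z, hz⟩, hne⟩ := exists_ne (⟨0, smul_zero 2⟩ : {z : G // 2 • z = 0})
  have hz0 : z ≠ 0 := fun h0 => hne (Subtype.ext h0)
  have hord : addOrderOf z = 2 := by
    have hdvd : addOrderOf z ∣ 2 := addOrderOf_dvd_of_nsmul_eq_zero hz
    rcases (Nat.dvd_prime Nat.prime_two).mp hdvd with h1 | h2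
    · exact absurd (AddMonoid.addOrderOf_eq_one_iff.mp h1) hz0
    · exact h2
  rw [← hord]
  exact addOrderOf_dvd_natCard z

omit [W.IsGloballyMinimal] in
/-- **`v₂(f_E(0)) ≥ 2` at a NON-SPLIT multiplicative `2` with odd torsion and even `#Sel_{2^∞}(E/ℚ)` (PROVED from
the display A235 `hEC`).** `f_E(0)·#E(ℚ)(2)² = u·2^{ord₂∏c + 1}·#Sel_{2^∞}(E/ℚ)`, `#E(ℚ)(2) = 1` (odd torsion order),
`2 ∣ #Sel` (`hsel₀`: a non-zero `2`-torsion Selmer class). [cite: GreenbergLNM1716, §4 pp. 112–113 (analogue of Thm. 4.1, l_v = 2)] -/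
theorem two_le_valuation_constantCoeff_of_eulerChar (hEC : TwoAdicEulerCharRankZeroNonsplitMult W 0)
    (hmult : Mult W 2) (hns : ¬ W.HasSplitMultiplicativeReductionAtPrime 2) (htors : ¬ 2 ∣ W.torsionOrder)
    {κ : ZpExtension ℚ 2} {γ : Field.absoluteGaloisGroup ℚ} (hκ : κ.IsCyclotomic) (hγ : κ.IsTopGenerator γ)
    (hγ' : IsCyclotomicVariable 2 γ) (D : W.SelmerDualData κ γ) (hX : D.IsTorsion) {fE : IwasawaAlgebra 2}
    (hfE : D.charIdeal = Ideal.span {fE}) (hfin : Finite (W.selmerGroupPInfty 2))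
    (hsel₀ : 2 ≤ Nat.card {z : W.selmerGroupPInfty 2 // 2 • z = 0}) :
    2 ≤ (PowerSeries.constantCoeff fE).valuation := by
  haveI : Module.Finite (IwasawaAlgebra 2) D.X := D.module_finite_holds hγ
  haveI := hfin
  obtain ⟨hEfin, hShapfin⟩ := (W.finite_selmerGroupPInfty_iff 2).mp hfin
  haveI := hEfin
  haveI := hShapfin
  obtain ⟨u₁, hu₁⟩ := hEC hmult hns κ γ hκ hγ hγ' D hX fE hfE hfin
  rw [add_zero, zpow_natCast] at hu₁
  obtain ⟨u₄, hu₄⟩ := exists_unit_torsionOrder_eq W 2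
  set v := padicValNat 2 W.tamagawaProduct with hv
  set Tp : ℚ_[2] := (Nat.card (AddCommGroup.primaryComponent W.toAffine.Point 2) : ℚ_[2]) with hTp
  set Sp : ℚ_[2] := (Nat.card (W.selmerGroupPInfty 2) : ℚ_[2]) with hSp
  have h20 : (2 : ℚ_[2]) ≠ 0 := two_ne_zero
  have hTp0 : Tp ≠ 0 := by rw [hTp]; exact_mod_cast Nat.card_pos.ne'
  have hSp0 : Sp ≠ 0 := by rw [hSp]; exact_mod_cast Nat.card_pos.ne'
  have hu₄' : (W.torsionOrder : ℚ_[2]) = ((u₄ : ℤ_[2]) : ℚ_[2]) * Tp := by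
    rw [hu₄, hTp]
    congr 1
    exact_mod_cast natCard_primaryComponent_point_congr W 2 _ _
  have hv2 : (2 : ℚ_[2]).valuation = 1 := by
    have h2 : ((2 : ℕ) : ℚ_[2]).valuation = 1 := Padic.valuation_p
    rwa [Nat.cast_ofNat] at h2
  -- valuation of `#E(ℚ)(2)`: zero (odd torsion order)
  have hvT : Tp.valuation = 0 := by
    have h := congrArg Padic.valuation hu₄'
    rw [Padic.valuation_natCast, Padic.valuation_mul (coe_units_ne_zero 2 u₄) hTp0,
      valuation_coe_units_eq_zero, zero_add] at h
    rw [← h]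
    exact_mod_cast padicValNat.eq_zero_of_not_dvd htors
  -- valuation of `#Sel`: at least one
  have hvS : 1 ≤ Sp.valuation := by
    rw [hSp, Padic.valuation_natCast]
    exact_mod_cast one_le_padicValNat_of_dvd Nat.card_pos.ne'
      (two_dvd_natCard_of_two_le_natCard_twoTorsion hsel₀)
  -- `f_E(0) ≠ 0`
  have hf0 : PowerSeries.constantCoeff fE ≠ 0 := by
    intro h0
    rw [h0, PadicInt.coe_zero, zero_mul] at hu₁
    exact (mul_ne_zero (mul_ne_zero (coe_units_ne_zero 2 u₁) (pow_ne_zero _ h20)) hSp0) hu₁.symm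
  have hf0Q : ((PowerSeries.constantCoeff fE : ℤ_[2]) : ℚ_[2]) ≠ 0 := PadicInt.coe_ne_zero.mpr hf0
  have hval := congrArg Padic.valuation hu₁
  rw [Padic.valuation_mul hf0Q (pow_ne_zero 2 hTp0), Padic.valuation_pow, hvT, mul_zero, add_zero,
    Padic.valuation_mul (mul_ne_zero (coe_units_ne_zero 2 u₁) (pow_ne_zero _ h20)) hSp0,
    Padic.valuation_mul (coe_units_ne_zero 2 u₁) (pow_ne_zero _ h20), valuation_coe_units_eq_zero,
    Padic.valuation_pow, hv2, zero_add, PadicInt.valuation_coe] at hval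
  have : (2 : ℤ) ≤ ((PowerSeries.constantCoeff fE).valuation : ℤ) := by
    rw [hval]; push_cast; omega
  exact_mod_cast this

/-! ## §2 The slope pinch on top of the integral divisibility: `char_Λ X = (L₀)` -/

/-- **The SLOPE PINCH from Kato WITH the `2`-power part (PROVED, pure algebra on top of T-KATO2-NSMULT).** A
cyclotomic dual datum `D` with `X` torsion and `L₀ ∈ char_Λ X = (f_X)`, `ι L₀ = ϖ·L`; certificates `μ(L₀) = 0`
(`hμan`), `v₂(L₀(0)) = s` even, `2^t ∣ [T¹]L₀`, `v₂([T²]L₀) = 1`, `s + 2 ≤ 2t`; the Selmer bound `3 ≤ λ(X)` once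
`μ(X) = 0` (`hlow`); and `v₂(f(0)) ≥ 2` for every generator `f` of `char_Λ X` (`hf0`, §1). Then `char_Λ X = (L₀)`:
`L₀ = f_X·b`, `μ(f_X) = 0`, and `SlopePinch.isUnit_of_slopePinch` makes `b` a unit.
[cite: Washington1997, §7.1] [cite: GreenbergVatsal2000, p. 4 (after Thm. (1.2))] -/
theorem charIdeal_eq_span_of_katoInt_slopePinch_nonsplit
    (hns : ¬ W.HasSplitMultiplicativeReductionAtPrime 2) (hμan : X2.AnalyticMuLE W 2 0)
    {κ : ZpExtension ℚ 2} {γ : Field.absoluteGaloisGroup ℚ} (hκ : κ.IsCyclotomic)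
    (hγ : κ.IsTopGenerator γ) (hγ' : IsCyclotomicVariable 2 γ)
    {N : ℕ} [NeZero N] {f : CuspForm (Gamma0 N) 2} (hf : IsNewformOf W f) {L : PowerSeries ℚ_[2]}
    (hLf : IsMultPAdicLFunctionOf f 2 (-1) L) (D : W.SelmerDualData κ γ) (hX : D.IsTorsion)
    {ϖ : ℚ} (hϖ : (ϖ : ℝ) * W.realPeriodRat = plusPeriod f) {L₀ : IwasawaAlgebra 2}
    (hL₀ : iwasawaToPowerSeries 2 L₀ = PowerSeries.C (ϖ : ℚ_[2]) * L)
    (hKL₀ : L₀ ∈ D.charIdeal) (hlow : SelmerLambdaLowerBoundAtTwo W 3)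
    (hf0 : ∀ fE : IwasawaAlgebra 2, D.charIdeal = Ideal.span {fE} → 2 ≤ (PowerSeries.constantCoeff fE).valuation)
    {s t : ℕ} (hc0 : PowerSeries.coeff 0 L₀ ≠ 0) (hs : (PowerSeries.coeff 0 L₀).valuation = s)
    (hc1 : (2 : ℤ_[2]) ^ t ∣ PowerSeries.coeff 1 L₀)
    (hc2 : PowerSeries.coeff 2 L₀ ≠ 0 ∧ (PowerSeries.coeff 2 L₀).valuation = 1)
    (hse : Even s) (hst : s + 2 ≤ 2 * t) :
    D.charIdeal = Ideal.span {L₀} := by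
  haveI : Module.Finite (IwasawaAlgebra 2) D.X := D.module_finite_holds hγ
  obtain ⟨k, hk⟩ := hμan f hf ϖ hϖ L (fun hsp => absurd hsp hns) (fun _ => hLf)
  rw [← hL₀] at hk
  have hμL₀ : mu L₀ = 0 := Nat.le_zero.mp (mu_le_of_lt_norm_coeff hk)
  have hL₀0 : L₀ ≠ 0 := by
    rintro rfl
    rw [map_zero, map_zero, norm_zero] at hk
    exact not_le.mpr hk (by positivity)
  haveI : (Module.charIdeal (IwasawaAlgebra 2) D.X).IsPrincipal := charIdeal_isPrincipal_holds 2 D.X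
  obtain ⟨fX, hfX⟩ := Submodule.IsPrincipal.principal (Module.charIdeal (IwasawaAlgebra 2) D.X)
  have hchar : D.charIdeal = Ideal.span {fX} := hfX
  have hfX0 : fX ≠ 0 := by
    intro h0
    refine Module.charIdeal_ne_bot (IwasawaAlgebra 2) D.X ?_
    change D.charIdeal = ⊥
    rw [hchar, h0]
    exact Ideal.span_singleton_eq_bot.mpr rfl
  rw [hchar] at hKL₀
  obtain ⟨b, hb⟩ := Ideal.mem_span_singleton'.mp hKL₀
  have hfac : L₀ = fX * b := by rw [mul_comm, hb]
  have hb0 : b ≠ 0 := by rintro rfl; exact hL₀0 (by rw [hfac, mul_zero])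
  have hμprod : mu (fX * b) = 0 := by rw [← hfac]; exact hμL₀
  have hμfX : mu fX = 0 := by
    have h := mu_le_mu_mul hfX0 hb0
    rw [hμprod] at h
    exact Nat.le_zero.mp h
  have hμX : D.mu = 0 := by
    rw [SelmerDualData.mu, ← mu_generator_eq_muInvariant D.X hX hfX0 hchar]; exact hμfX
  have hlamfX : lam fX = D.lambda := lam_generator_eq_lambdaInvariant D.X hX hfX0 hchar
  have hle : 3 ≤ lam fX := by rw [hlamfX]; exact hlow κ γ hκ hγ hγ' D hX hμX
  have hfX00 : 2 ≤ (PowerSeries.coeff 0 fX).valuation := by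
    rw [PowerSeries.coeff_zero_eq_constantCoeff_apply]; exact hf0 fX hchar
  rw [hfac] at hc0 hs hc1 hc2
  have hspan : Ideal.span ({L₀} : Set (IwasawaAlgebra 2)) = Ideal.span {fX} := by
    rw [hfac]
    exact span_mul_eq_span_of_slopePinch hfX0 hb0 hμprod hle hfX00 hc0 hs hc1 hc2 hse hst
  rw [hchar, hspan]

/-! ## §3 The doors -/

/-- **DOOR (SLOPE pinch, non-split): `BSDp W 2`, both halves,** for `W/ℚ` globally minimal of analytic rank `0`,
NON-SPLIT multiplicative at `2`, `ρ_{E,2^∞}` surjective, `Δ < 0`. Binders: PRINT {guarded Thm-4.1 analogue `h41`,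
modularity `hmod`, GZK `hGZK`, Greenberg Prop. 4.14@2 `h414`}; MEMO {T-KATO2-NSMULT `hKint`}; CERTIFICATES
{`μ_an(E) = 0` (`hμan`), the coefficient valuations of `ϖ·L₂(E)` (`hcoef`: `v₂(c₀) = s`, `2^t ∣ c₁`, `v₂(c₂) = 1`),
the numerics `s` even and `s + 2 ≤ 2t`, the layer count `2³ ≤ #Sel_{2^∞}(E/ℚ_j)[2]` (`hsel`), `2 ≤ #Sel_{2^∞}(E/ℚ)[2]`
(`hsel₀`), `0 ≤ ord₂ ϖ` (`hper₀`)}; analytic rank `0`. Chain: `hKint` ⇒ `X` torsion ∧ `L₀ ∈ char X`; §1 ⇒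
`v₂(f_X(0)) ≥ 2`; `selmerLambdaLowerBoundAtTwo_of_layerSelmer` ⇒ `3 ≤ λ(X)`; §2 ⇒ `char X = (L₀)`;
`missingPPartAt_two_nonsplit_of_charIdeal_eq_span` ⇒ `ord₂ #Ш_an = ord₂ #Ш`; `bsdp_of_missingPPartAt`. NO `λ_an`
certificate, NO `λ(X) ≥ λ_an`. [cite: GreenbergLNM1716, §4 pp. 112–113 and Prop. 4.14 (p. 124)]
[cite: MazurTateTeitelbaum1986Invent, §I.14 (L(0) = (1 − α⁻¹)[0]⁺, α = −1)] [cite: Washington1997, §7.1]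
[cite: Miller2011LMS, Def. 1.1 and §1] -/
theorem bsdp_two_nonsplit_of_katoInt_slopePinch {j s t : ℕ}
    (h41 : thm41Analogue_charValue_rankZero_numberField_anyPrime_oddLocalDegree)
    (hmod : nonempty_modularParametrizationData)
    (hGZK : rank_eq_analyticRank_of_analyticRank_le_one)
    (h414 : prop414_noFiniteSubmodule_of_not_dvd_torsionOrder)
    (hKint : KatoDivisibilityAtTwoNonsplitMultInt W)
    (hper₀ : ∀ [NeZero (W.conductorNorm ℤ)] (f : CuspForm (Gamma0 (W.conductorNorm ℤ)) 2),
      IsNewformOf W f → ∀ ϖ : ℚ, (ϖ : ℝ) * W.realPeriodRat = plusPeriod f → 0 ≤ padicValRat 2 ϖ)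
    (hr : W.analyticRank = 0) (hmult : Mult W 2) (hns : ¬ W.HasSplitMultiplicativeReductionAtPrime 2)
    (him : TwoAdicSurjective W) (hΔ : W.Δ < 0) (hμan : X2.AnalyticMuLE W 2 0)
    (hcoef : ∀ {N : ℕ} [NeZero N] (f : CuspForm (Gamma0 N) 2), IsNewformOf W f →
      ∀ (ϖ : ℚ), (ϖ : ℝ) * W.realPeriodRat = plusPeriod f →
      ∀ (L : PowerSeries ℚ_[2]), IsMultPAdicLFunctionOf f 2 (-1) L →
      ∀ (G : IwasawaAlgebra 2), iwasawaToPowerSeries 2 G = PowerSeries.C (ϖ : ℚ_[2]) * L →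
        (PowerSeries.coeff 0 G).valuation = s ∧ (2 : ℤ_[2]) ^ t ∣ PowerSeries.coeff 1 G ∧
          PowerSeries.coeff 2 G ≠ 0 ∧ (PowerSeries.coeff 2 G).valuation = 1)
    (hse : Even s) (hst : s + 2 ≤ 2 * t)
    (hsel : ∀ κ : ZpExtension ℚ 2, κ.IsCyclotomic →
      2 ^ 3 ≤ Nat.card {z : W.selmerLayer κ j // 2 • z = 0})
    (hsel₀ : 2 ≤ Nat.card {z : W.selmerGroupPInfty 2 // 2 • z = 0}) : BSDp W 2 := by
  haveI : NeZero (W.conductorNorm ℤ) := ⟨(W.conductorNorm_pos_holds).ne'⟩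
  obtain ⟨Dm⟩ := hmod W
  have hf : IsNewformOf W Dm.f := Dm.isNewformOf
  have hL : W.entireLFunction 1 ≠ 0 :=
    (W.analyticRank_eq_zero_iff_holds hf.hasEntireLFunction).mp hr
  obtain ⟨ϖ, -, hϖ, -⟩ := Dm.exists_rat_mul_realPeriodRat_eq_plusPeriod
  obtain ⟨κ, hκ, γ, hγ, hγ'⟩ := exists_isCyclotomic_isTopGenerator_isCyclotomicVariable_holds 2
  obtain ⟨DW⟩ := W.nonempty_selmerDualData_holds κ γ hγ
  haveI : Module.Finite (IwasawaAlgebra 2) DW.X := DW.module_finite_holds hγ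
  obtain ⟨L, hLf⟩ := exists_isMultPAdicLFunctionOf_neg_one_of_nonsplit hf hmult hns
  obtain ⟨L₀, hL₀⟩ := exists_iwasawaToPowerSeries_eq_C_mul_of_isMultPAdicLFunctionOf_neg_one_two hf
    hmult hns (hper₀ Dm.f hf ϖ hϖ) hLf
  obtain ⟨hX, hKL₀⟩ := hKint hmult hns him hΔ Dm.f hf L hLf κ γ hκ hγ hγ' DW ϖ hϖ L₀ hL₀
  -- the interpolation: `L₀(0) = ϖ · 2 · [0]⁺_f ≠ 0`
  have hΩpos : 0 < W.realPeriodRat := W.realPeriodRat_pos_holds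
  have hϖ0 : ϖ ≠ 0 := by
    rintro rfl
    have hper : 0 < plusPeriod Dm.f := IsNewform0.plusPeriod_pos_holds hf.1 hf.coeffField_eq_bot
    rw [← hϖ, Rat.cast_zero, zero_mul] at hper
    exact lt_irrefl _ hper
  set sy : ℚ := ratPlusSymbol Dm.f 0 with hsy_def
  have hLval : W.entireLFunction 1 = (((sy : ℝ) * plusPeriod Dm.f : ℝ) : ℂ) := hf.entireLFunction_one_eq
  have hsy0 : sy ≠ 0 := by
    intro h0
    apply hL
    rw [hLval, h0]
    simp
  have hg0 : ((PowerSeries.constantCoeff L₀ : ℤ_[2]) : ℚ_[2]) = (ϖ : ℚ_[2]) * (2 * (sy : ℚ_[2])) := by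
    rw [← constantCoeff_iwasawaToPowerSeries 2 L₀, hL₀, map_mul, PowerSeries.constantCoeff_C,
      hLf.constantCoeff_of_neg_one]
  have hc0 : PowerSeries.coeff 0 L₀ ≠ 0 := by
    rw [PowerSeries.coeff_zero_eq_constantCoeff_apply]
    intro h0
    rw [h0, PadicInt.coe_zero] at hg0
    exact (mul_ne_zero (by exact_mod_cast hϖ0 : (ϖ : ℚ_[2]) ≠ 0)
      (mul_ne_zero two_ne_zero (by exact_mod_cast hsy0 : (sy : ℚ_[2]) ≠ 0))) hg0.symm
  -- `v₂(f(0)) ≥ 2` for every generator `f` of `char X`: Sel finite by control, then §1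
  have htors : ¬ 2 ∣ W.torsionOrder := not_two_dvd_torsionOrder_of_twoAdicSurjective W him
  have hf0 : ∀ fE : IwasawaAlgebra 2, DW.charIdeal = Ideal.span {fE} →
      2 ≤ (PowerSeries.constantCoeff fE).valuation := by
    intro fE hfE
    have hfE0 : PowerSeries.constantCoeff fE ≠ 0 := by
      rw [hfE] at hKL₀
      obtain ⟨b, hb⟩ := Ideal.mem_span_singleton'.mp hKL₀
      intro h0
      apply hc0
      rw [PowerSeries.coeff_zero_eq_constantCoeff_apply, ← hb, map_mul, h0, mul_zero]
    have hSelfin : Finite (W.selmerGroupPInfty 2) :=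
      DW.finite_selmerGroupPInfty_of_constantCoeff_ne_zero W hγ hX fE hfE hfE0
    exact two_le_valuation_constantCoeff_of_eulerChar W (twoAdicEulerCharRankZeroNonsplitMult_zero_of_greenberg' W h41)
      hmult hns htors hκ hγ hγ' DW hX hfE hSelfin hsel₀
  obtain ⟨hs, hc1, hc2⟩ := hcoef Dm.f hf ϖ hϖ L hLf L₀ hL₀
  have hchar := charIdeal_eq_span_of_katoInt_slopePinch_nonsplit W hns hμan hκ hγ hγ' hf hLf DW hX hϖ hL₀ hKL₀
    (selmerLambdaLowerBoundAtTwo_of_layerSelmer W h414 htors hsel) hf0 hc0 hs hc1 hc2 hse hst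
  exact bsdp_of_missingPPartAt W 2 hGZK (by rw [hr]; exact zero_le_one)
    (missingPPartAt_two_nonsplit_of_charIdeal_eq_span W
      (twoAdicEulerCharRankZeroNonsplitMult_zero_of_greenberg' W h41) hGZK hmult hns hL hκ hγ hγ' hf hLf
      DW hX hϖ hL₀ hchar)

/-- **Item 19923 AT the curve: `Typed.MissingLowerBoundAt W 2` (`ord₂ #Ш_an ≤ ord₂ #Ш`) from the slope-pinch door**
(same inputs; `lower_and_upper_of_missingPPartAt`). [cite: Miller2011LMS, Def. 1.1 (arXiv:1010.2431 p. 3)]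
[cite: GreenbergLNM1716, §4 pp. 112–113 and Prop. 4.14 (p. 124)] -/
theorem missingLowerBoundAt_two_nonsplit_of_katoInt_slopePinch {j s t : ℕ}
    (h41 : thm41Analogue_charValue_rankZero_numberField_anyPrime_oddLocalDegree)
    (hmod : nonempty_modularParametrizationData)
    (hGZK : rank_eq_analyticRank_of_analyticRank_le_one)
    (h414 : prop414_noFiniteSubmodule_of_not_dvd_torsionOrder)
    (hKint : KatoDivisibilityAtTwoNonsplitMultInt W)
    (hper₀ : ∀ [NeZero (W.conductorNorm ℤ)] (f : CuspForm (Gamma0 (W.conductorNorm ℤ)) 2),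
      IsNewformOf W f → ∀ ϖ : ℚ, (ϖ : ℝ) * W.realPeriodRat = plusPeriod f → 0 ≤ padicValRat 2 ϖ)
    (hr : W.analyticRank = 0) (hmult : Mult W 2) (hns : ¬ W.HasSplitMultiplicativeReductionAtPrime 2)
    (him : TwoAdicSurjective W) (hΔ : W.Δ < 0) (hμan : X2.AnalyticMuLE W 2 0)
    (hcoef : ∀ {N : ℕ} [NeZero N] (f : CuspForm (Gamma0 N) 2), IsNewformOf W f →
      ∀ (ϖ : ℚ), (ϖ : ℝ) * W.realPeriodRat = plusPeriod f →
      ∀ (L : PowerSeries ℚ_[2]), IsMultPAdicLFunctionOf f 2 (-1) L →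
      ∀ (G : IwasawaAlgebra 2), iwasawaToPowerSeries 2 G = PowerSeries.C (ϖ : ℚ_[2]) * L →
        (PowerSeries.coeff 0 G).valuation = s ∧ (2 : ℤ_[2]) ^ t ∣ PowerSeries.coeff 1 G ∧
          PowerSeries.coeff 2 G ≠ 0 ∧ (PowerSeries.coeff 2 G).valuation = 1)
    (hse : Even s) (hst : s + 2 ≤ 2 * t)
    (hsel : ∀ κ : ZpExtension ℚ 2, κ.IsCyclotomic →
      2 ^ 3 ≤ Nat.card {z : W.selmerLayer κ j // 2 • z = 0})
    (hsel₀ : 2 ≤ Nat.card {z : W.selmerGroupPInfty 2 // 2 • z = 0}) : MissingLowerBoundAt W 2 := by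
  haveI : Finite W.sha := (hGZK W (by rw [hr]; exact zero_le_one)).2
  exact (lower_and_upper_of_missingPPartAt W 2 (missingPPartAt_of_bsdp W 2
    (bsdp_two_nonsplit_of_katoInt_slopePinch W h41 hmod hGZK h414 hKint hper₀ hr hmult hns him hΔ hμan hcoef hse
      hst hsel hsel₀))).1

/-- **DOOR (SLOPE pinch, non-split), DISPLAY FORM: `hper₀` DISCHARGED by Česnavičius** (`2 ∥ N ⇒` odd Manin
constant; on the surjective locus `ord₂ ϖ = 0`, this seat's `periodRatio_nonneg_of_twoAdicSurjective_of_cesnavicius`).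
[cite: Cesnavicius2018, Thm. 1.2] [cite: GreenbergLNM1716, §4 pp. 112–113 and Prop. 4.14 (p. 124)]
[cite: Miller2011LMS, Def. 1.1 and §1] -/
theorem bsdp_two_nonsplit_of_katoInt_slopePinch_display {j s t : ℕ}
    (h41 : thm41Analogue_charValue_rankZero_numberField_anyPrime_oddLocalDegree)
    (hmod : nonempty_modularParametrizationData)
    (hGZK : rank_eq_analyticRank_of_analyticRank_le_one)
    (h414 : prop414_noFiniteSubmodule_of_not_dvd_torsionOrder)
    (hC : cesnavicius_not_two_dvd_maninConstant_of_two_dvd_level)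
    (hKint : KatoDivisibilityAtTwoNonsplitMultInt W)
    (hr : W.analyticRank = 0) (hmult : Mult W 2) (hns : ¬ W.HasSplitMultiplicativeReductionAtPrime 2)
    (him : TwoAdicSurjective W) (hΔ : W.Δ < 0) (hμan : X2.AnalyticMuLE W 2 0)
    (hcoef : ∀ {N : ℕ} [NeZero N] (f : CuspForm (Gamma0 N) 2), IsNewformOf W f →
      ∀ (ϖ : ℚ), (ϖ : ℝ) * W.realPeriodRat = plusPeriod f →
      ∀ (L : PowerSeries ℚ_[2]), IsMultPAdicLFunctionOf f 2 (-1) L →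
      ∀ (G : IwasawaAlgebra 2), iwasawaToPowerSeries 2 G = PowerSeries.C (ϖ : ℚ_[2]) * L →
        (PowerSeries.coeff 0 G).valuation = s ∧ (2 : ℤ_[2]) ^ t ∣ PowerSeries.coeff 1 G ∧
          PowerSeries.coeff 2 G ≠ 0 ∧ (PowerSeries.coeff 2 G).valuation = 1)
    (hse : Even s) (hst : s + 2 ≤ 2 * t)
    (hsel : ∀ κ : ZpExtension ℚ 2, κ.IsCyclotomic →
      2 ^ 3 ≤ Nat.card {z : W.selmerLayer κ j // 2 • z = 0})
    (hsel₀ : 2 ≤ Nat.card {z : W.selmerGroupPInfty 2 // 2 • z = 0}) : BSDp W 2 :=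
  bsdp_two_nonsplit_of_katoInt_slopePinch W h41 hmod hGZK h414 hKint
    (MultSelmerRank.periodRatio_nonneg_of_twoAdicSurjective_of_cesnavicius W hC hmult him) hr hmult hns him hΔ
    hμan hcoef hse hst hsel hsel₀

/-- **Item 19923 AT the curve, DISPLAY FORM** (`hper₀` discharged by Česnavičius). [cite: Cesnavicius2018, Thm. 1.2]
[cite: Miller2011LMS, Def. 1.1 (arXiv:1010.2431 p. 3)] -/
theorem missingLowerBoundAt_two_nonsplit_of_katoInt_slopePinch_display {j s t : ℕ}
    (h41 : thm41Analogue_charValue_rankZero_numberField_anyPrime_oddLocalDegree)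
    (hmod : nonempty_modularParametrizationData)
    (hGZK : rank_eq_analyticRank_of_analyticRank_le_one)
    (h414 : prop414_noFiniteSubmodule_of_not_dvd_torsionOrder)
    (hC : cesnavicius_not_two_dvd_maninConstant_of_two_dvd_level)
    (hKint : KatoDivisibilityAtTwoNonsplitMultInt W)
    (hr : W.analyticRank = 0) (hmult : Mult W 2) (hns : ¬ W.HasSplitMultiplicativeReductionAtPrime 2)
    (him : TwoAdicSurjective W) (hΔ : W.Δ < 0) (hμan : X2.AnalyticMuLE W 2 0)
    (hcoef : ∀ {N : ℕ} [NeZero N] (f : CuspForm (Gamma0 N) 2), IsNewformOf W f →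
      ∀ (ϖ : ℚ), (ϖ : ℝ) * W.realPeriodRat = plusPeriod f →
      ∀ (L : PowerSeries ℚ_[2]), IsMultPAdicLFunctionOf f 2 (-1) L →
      ∀ (G : IwasawaAlgebra 2), iwasawaToPowerSeries 2 G = PowerSeries.C (ϖ : ℚ_[2]) * L →
        (PowerSeries.coeff 0 G).valuation = s ∧ (2 : ℤ_[2]) ^ t ∣ PowerSeries.coeff 1 G ∧
          PowerSeries.coeff 2 G ≠ 0 ∧ (PowerSeries.coeff 2 G).valuation = 1)
    (hse : Even s) (hst : s + 2 ≤ 2 * t)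
    (hsel : ∀ κ : ZpExtension ℚ 2, κ.IsCyclotomic →
      2 ^ 3 ≤ Nat.card {z : W.selmerLayer κ j // 2 • z = 0})
    (hsel₀ : 2 ≤ Nat.card {z : W.selmerGroupPInfty 2 // 2 • z = 0}) : MissingLowerBoundAt W 2 :=
  missingLowerBoundAt_two_nonsplit_of_katoInt_slopePinch W h41 hmod hGZK h414 hKint
    (MultSelmerRank.periodRatio_nonneg_of_twoAdicSurjective_of_cesnavicius W hC hmult him) hr hmult hns him hΔ
    hμan hcoef hse hst hsel hsel₀

end Summit.BirchSwinnertonDyer.BirchSwinnertonDyer.Theorems.MultSlopePinch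

end
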